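import Summits.CriticalPhenomena.PercolationContinuityZ3.Theorems.Transplant.SkelPhiNegReachRoomsRead
import Summits.CriticalPhenomena.PercolationContinuityZ3.Theorems.Transplant.SkelPhiNegReachRooms
import HarnessLib

/-!
# N1 (the `{±1}` node), LEVEL 2½, (C) column under RULING B.15 (S1, SMALL ARRIVAL BOX `M := cen ± b`): the LANDING ROOMS at the small box —
# the planar unit-box lemma `PCells2.Icc_unit_subset_box_add_of_lev` (readings `20r∥ − b∥ + 1 ≤ lev ≤ 20r∥ + b∥ − 1`, `|z⊥ − cen⊥| ≤ b⊥ − 1` put the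
# unit box of `z` inside `cen(y+du) ± b`), the reading form `Skelφ.room_last_of_rd_b` / `roomLb_of_rd` (the band's last core read at the frame-change
# vertex), and the two vertex-level M-readers of the twin scheme stated AGAINST THE LITERAL SET `VWin G ψ w₀ (Icc (cen − b) (cen + b)) (Λ.rM a v)`
# (so they serve hp-8's `cellGeomSG₂b` whatever its packaging): `mem_Mb_of_mem_Hfull₂`, `mem_Mb_of_mem_habΩ₂` (the form of `hlast₂` of
# `reachOblAtHN_of_chain₂`).  Everything M-free is reused from C-R / C-A4 (p5-g8).

builds on p205010 (kernel theorem, internal audit signed; external expert review pending) — nothing in this file uses p205010; nothing here is a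
claim about the open node `SamePDropOfSkeletonNeg`.
Lane `prim-bschramm`, seat `prim-bschramm-p5` (gen 9; (C) lineage; C-STEP0.md §4–§5); helper file (`--supports stmt-CriticalPhenomena-4575`).
[cite: KozmaNitzan2024, §4 pp. 25–27 (M_v, H_{v,x}), Lemma 12 (pp. 23–25)]
-/

noncomputable section

open scoped Classical

namespace Summit.CriticalPhenomena.PercolationContinuityZ3.Theorems

namespace Transplant

open Literature.Probability.Percolation Literature.Probability.LatticeModels SimpleGraph GadgetSystem Contour
open Literature.Probability.Percolation.KozmaNitzan
open Literature.Probability.Percolation.KozmaNitzan.Cells (oth oth_ne sgOf sgOf_sign stepVec_apply_fst stepVec_apply_oth eq_oth_of_ne oth_oth)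

/-! ## §1 The planar unit box at the small arrival box -/

namespace PCells2

variable (P : PCells2) {y : Site 2} {du : MDir} {z : Site 2} {b : Site 2}

/-- **The unit box of `z` lies in the small box `cen(y+du) ± b`** from `20r∥ − b∥ + 1 ≤ lev ≤ 20r∥ + b∥ − 1` (level form along `du`) and
`|z⊥ − cen⊥| ≤ b⊥ − 1`. [cite: KozmaNitzan2024, §4 p. 26 (M_v)] -/
theorem Icc_unit_subset_box_add_of_lev (h1 : 20 * (P.r du.1 : ℤ) - b du.1 + 1 ≤ P.lev du y z) (h2 : P.lev du y z ≤ 20 * (P.r du.1 : ℤ) + b du.1 - 1)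
    (h3 : P.cen y (oth du.1) - b (oth du.1) + 1 ≤ z (oth du.1)) (h4 : z (oth du.1) ≤ P.cen y (oth du.1) + b (oth du.1) - 1) :
    Finset.Icc (z - 1) (z + 1) ⊆ Finset.Icc (P.cen (y + stepVec du) - b) (P.cen (y + stepVec du) + b) := by
  intro x hx
  rw [Finset.mem_Icc, Pi.le_def, Pi.le_def] at hx
  obtain ⟨hxl, hxu⟩ := hx
  rw [Finset.mem_Icc, Pi.le_def, Pi.le_def]
  refine ⟨fun i => ?_, fun i => ?_⟩
  · by_cases hi : i = du.1
    · subst hi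
      rw [lev_def] at h1 h2
      have hl := hxl du.1
      simp only [Pi.sub_apply, Pi.one_apply] at hl ⊢
      rw [cen_add_stepVec_fst]
      rcases sgOf_sign du with hs | hs <;> rw [hs] at h1 h2 ⊢ <;> linarith
    · rw [eq_oth_of_ne hi, Pi.sub_apply, cen_add_stepVec_oth]
      have hl := hxl (oth du.1)
      simp only [Pi.sub_apply, Pi.one_apply] at hl
      linarith
  · by_cases hi : i = du.1
    · subst hi
      rw [lev_def] at h1 h2
      have hu := hxu du.1
      simp only [Pi.add_apply, Pi.one_apply] at hu ⊢
      rw [cen_add_stepVec_fst]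
      rcases sgOf_sign du with hs | hs <;> rw [hs] at h1 h2 ⊢ <;> linarith
    · rw [eq_oth_of_ne hi, Pi.add_apply, cen_add_stepVec_oth]
      have hu := hxu (oth du.1)
      simp only [Pi.add_apply, Pi.one_apply] at hu
      linarith

end PCells2

namespace Skelφ

open Literature.Barriers.CriticalPhenomena (graphBall mem_graphBall_self graphBall_mono)
open BoxProdZ2 (ConcRadiiG)
open PlanarSkeletonConc (mem_vspan_edgesIn_iff mem_vspan_edgesIn_of_adj)
open TwoAxis.Para (modulus)
open ChainPlanar ChainPara

variable {V : Type} {G : SimpleGraph V}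

/-! ## §2 The last core read at the frame-change vertex: footprints in `H_{y,du}`, unit boxes in the small box -/

section Read

variable {φ : V → Site 2} {t₀ c₀ : V} {A : ℤ} {n : ℕ} {h vα vβ c₀' c₁' s₀ s₁ D : ℤ} {P : PCells2} {y : Site 2} {du : MDir} {b : Site 2}

/-- **The last core's footprints lie in `H_{y,du}` with their unit boxes in the small box `cen(y+du) ± b`** from the readings: along
`20r∥ − b∥ + 1 ≤ rd∥ ≤ 20r∥ + b∥ − 1` (sign-split; `b∥ ≤ 2r∥`), across `|rd⊥ − cen⊥| ≤ b⊥ − 1` (`b⊥ ≤ 2r⊥ + 1`). [cite: KozmaNitzan2024, §4 p. 26 (M_v, H_{v,x})] -/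
theorem room_last_of_rd_b (hA : 0 ≤ A) (hn : 1 ≤ n) (hm : 0 ≤ modulus n h vα vβ) (hc₀ : 0 ≤ c₀') (hc₁ : 0 ≤ c₁') (hD : 0 < D)
    (hcen : fineSkel φ t₀ A n h vα vβ c₀' c₁' s₀ s₁ D c₀ = P.cen y) (hbpar : b du.1 ≤ 2 * (P.r du.1 : ℤ)) (hbperp : b (oth du.1) ≤ 2 * (P.r (oth du.1) : ℤ) + 1)
    {lo hi : Site 2}
    (hl₁ : sgOf du = 1 → 20 * (P.r du.1 : ℤ) - b du.1 + 1 ≤ rdLo A n h vα vβ c₀' c₁' D lo hi du.1 ∧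
      rdHi A n h vα vβ c₀' c₁' D lo hi du.1 ≤ 20 * (P.r du.1 : ℤ) + b du.1 - 1)
    (hl₂ : sgOf du = -1 → 20 * (P.r du.1 : ℤ) - b du.1 + 1 ≤ -rdHi A n h vα vβ c₀' c₁' D lo hi du.1 ∧
      -rdLo A n h vα vβ c₀' c₁' D lo hi du.1 ≤ 20 * (P.r du.1 : ℤ) + b du.1 - 1)
    (ht : -(b (oth du.1)) + 1 ≤ rdLo A n h vα vβ c₀' c₁' D lo hi (oth du.1) ∧ rdHi A n h vα vβ c₀' c₁' D lo hi (oth du.1) ≤ b (oth du.1) - 1)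
    {v : V} (hv : runX φ c₀ n h 1 v ∈ Finset.Icc lo hi) :
    fineSkel φ t₀ A n h vα vβ c₀' c₁' s₀ s₁ D v ∈ P.Hfull y du ∧
      Finset.Icc (fineSkel φ t₀ A n h vα vβ c₀' c₁' s₀ s₁ D v - 1) (fineSkel φ t₀ A n h vα vβ c₀' c₁' s₀ s₁ D v + 1) ⊆
        Finset.Icc (P.cen (y + stepVec du) - b) (P.cen (y + stepVec du) + b) := by
  have hpar := fine_sub_cen_mem_rd hA hn hm hc₀ hc₁ hD hcen hv du.1
  have hperp := fine_sub_cen_mem_rd hA hn hm hc₀ hc₁ hD hcen hv (oth du.1)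
  have hlev : 20 * (P.r du.1 : ℤ) - b du.1 + 1 ≤ P.lev du y (fineSkel φ t₀ A n h vα vβ c₀' c₁' s₀ s₁ D v) ∧
      P.lev du y (fineSkel φ t₀ A n h vα vβ c₀' c₁' s₀ s₁ D v) ≤ 20 * (P.r du.1 : ℤ) + b du.1 - 1 := by
    rw [PCells2.lev_def]
    rcases sgOf_sign du with hs | hs <;> rw [hs]
    · obtain ⟨h1, h2⟩ := hl₁ hs; constructor <;> linarith [hpar.1, hpar.2]
    · obtain ⟨h1, h2⟩ := hl₂ hs; constructor <;> linarith [hpar.1, hpar.2]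
  refine ⟨P.mem_Hfull_of_lev (by linarith [hlev.1]) (by linarith [hlev.2]) (by linarith [hperp.1, ht.1]) (by linarith [hperp.2, ht.2]),
    P.Icc_unit_subset_box_add_of_lev hlev.1 hlev.2 (by linarith [hperp.1, ht.1]) (by linarith [hperp.2, ht.2])⟩

/-- **The band's last core `B.pcore aB σB 0 (B.N+1)` has footprints in `H_{y,du}` with unit boxes in the small box `cen(y+du) ± b`** from the readings of
its corners. [cite: KozmaNitzan2024, §4 Lemma 12 (pp. 23–25), p. 26 (M_v)] -/
theorem roomLb_of_rd (hA : 0 ≤ A) (hn : 1 ≤ n) (hm : 0 ≤ modulus n h vα vβ) (hc₀ : 0 ≤ c₀') (hc₁ : 0 ≤ c₁') (hD : 0 < D)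
    (hcen : fineSkel φ t₀ A n h vα vβ c₀' c₁' s₀ s₁ D c₀ = P.cen y) (hbpar : b du.1 ≤ 2 * (P.r du.1 : ℤ)) (hbperp : b (oth du.1) ≤ 2 * (P.r (oth du.1) : ℤ) + 1)
    (B : RunPrm) (aB : Fin 2) (σB : ℤ)
    (hrd :
      let lo := dLo aB σB 0 (B.aLo (B.N + 1)) (B.aHi (B.N + 1)) (B.bLo (B.N + 1)) (B.bHi (B.N + 1))
      let hi := dHi aB σB 0 (B.aLo (B.N + 1)) (B.aHi (B.N + 1)) (B.bLo (B.N + 1)) (B.bHi (B.N + 1))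
      (sgOf du = 1 → 20 * (P.r du.1 : ℤ) - b du.1 + 1 ≤ rdLo A n h vα vβ c₀' c₁' D lo hi du.1 ∧
        rdHi A n h vα vβ c₀' c₁' D lo hi du.1 ≤ 20 * (P.r du.1 : ℤ) + b du.1 - 1) ∧
      (sgOf du = -1 → 20 * (P.r du.1 : ℤ) - b du.1 + 1 ≤ -rdHi A n h vα vβ c₀' c₁' D lo hi du.1 ∧
        -rdLo A n h vα vβ c₀' c₁' D lo hi du.1 ≤ 20 * (P.r du.1 : ℤ) + b du.1 - 1) ∧
      (-(b (oth du.1)) + 1 ≤ rdLo A n h vα vβ c₀' c₁' D lo hi (oth du.1) ∧ rdHi A n h vα vβ c₀' c₁' D lo hi (oth du.1) ≤ b (oth du.1) - 1)) :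
    ∀ v : V, runX φ c₀ n h 1 v ∈ B.pcore aB σB 0 (B.N + 1) →
      fineSkel φ t₀ A n h vα vβ c₀' c₁' s₀ s₁ D v ∈ P.Hfull y du ∧
        Finset.Icc (fineSkel φ t₀ A n h vα vβ c₀' c₁' s₀ s₁ D v - 1) (fineSkel φ t₀ A n h vα vβ c₀' c₁' s₀ s₁ D v + 1) ⊆
          Finset.Icc (P.cen (y + stepVec du) - b) (P.cen (y + stepVec du) + b) := by
  intro v hv
  obtain ⟨h1, h2, h3⟩ := hrd
  exact room_last_of_rd_b hA hn hm hc₀ hc₁ hD hcen hbpar hbperp h1 h2 h3 hv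

end Read

/-! ## §3 The vertex-level M-readers at the small box (any packaging of the twin scheme) -/

section Rooms

variable [DecidableEq V] [G.LocallyFinite] {ψ : V → Site 2} {P : PCells2} {w₀ : V} {Λ : ConcRadiiG} {α a' : ℕ} {e : Site 2 × MDir} {du : MDir} {b : Site 2}

/-- **A vertex of the corridor span whose unit box lies in the small box `cen(y+du) ± b` lies in `VWin ψ (cen(y+du) ± b) (rM a' (y+du))`** (a span
neighbour, `Lip`, and the depth room `Λ.ρ a' y du ℓ + 1 ≤ Λ.rM a' (y+du)`). [cite: KozmaNitzan2024, §4 pp. 26–27] -/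
theorem mem_Mb_of_mem_Hfull₂ (hlip : Lip G ψ) {y : Site 2} (hρM : ∀ ℓ, Λ.ρ a' y du ℓ + 1 ≤ Λ.rM a' (y + stepVec du)) {v : V}
    (hvH : v ∈ (faceDataSG G ψ P w₀ Λ).Hfull a' y du)
    (hbox : Finset.Icc (ψ v - 1) (ψ v + 1) ⊆ Finset.Icc (P.cen (y + stepVec du) - b) (P.cen (y + stepVec du) + b)) :
    v ∈ VWin G ψ w₀ (Finset.Icc (P.cen (y + stepVec du) - b) (P.cen (y + stepVec du) + b)) (Λ.rM a' (y + stepVec du)) := by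
  have hvM0 : ψ v ∈ Finset.Icc (P.cen (y + stepVec du) - b) (P.cen (y + stepVec du) + b) :=
    hbox (Finset.mem_Icc.2 ⟨fun i => by simp, fun i => by simp⟩)
  change v ∈ VStair G ψ w₀ (P.Hfull y du) (prof P Λ a' y du) at hvH
  obtain ⟨z, hz, hvz⟩ := exists_adj_of_mem_VStair hvH
  obtain ⟨-, hdv⟩ := mem_of_mem_VStair hvH
  obtain ⟨-, hdz⟩ := mem_of_mem_VStair hz
  have hψz : ψ z ∈ Finset.Icc (P.cen (y + stepVec du) - b) (P.cen (y + stepVec du) + b) := by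
    refine hbox (Finset.mem_Icc.2 ⟨fun i => ?_, fun i => ?_⟩)
    · have := (abs_le.1 (hlip hvz i)).2; simp only [Pi.sub_apply, Pi.one_apply]; linarith
    · have := (abs_le.1 (hlip hvz i)).1; simp only [Pi.add_apply, Pi.one_apply]; linarith
  have hvW : v ∈ Win G ψ w₀ (Finset.Icc (P.cen (y + stepVec du) - b) (P.cen (y + stepVec du) + b)) (Λ.rM a' (y + stepVec du)) :=
    (mem_Win G ψ).2 ⟨graphBall_mono G w₀ (by unfold prof; exact (Nat.le_succ _).trans (hρM _)) hdv, hvM0⟩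
  have hzW : z ∈ Win G ψ w₀ (Finset.Icc (P.cen (y + stepVec du) - b) (P.cen (y + stepVec du) + b)) (Λ.rM a' (y + stepVec du)) :=
    (mem_Win G ψ).2 ⟨graphBall_mono G w₀ (by unfold prof; exact (Nat.le_succ _).trans (hρM _)) hdz, hψz⟩
  exact (mem_vspan_edgesIn_of_adj hvW hzW hvz).1

/-- **A vertex of the fresh habitat with footprint in `P.Hfull y du` whose unit box lies in the small box lies in `VWin ψ (cen(y+du) ± b) (rM a' (y+du))`**
(`b ≤ 3r` componentwise, so the small box lies in `P.M (y+du) ⊆ P.Q (y+du)`, planar-disjoint from `P.Q y`) — the form of `hlast₂` of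
`reachOblAtHN_of_chain₂` at the twin scheme. [cite: KozmaNitzan2024, §4 pp. 26–27] -/
theorem mem_Mb_of_mem_habΩ₂ (hlip : Lip G ψ) (hdu : du ≠ rev e.2) (hρM : ∀ ℓ, Λ.ρ a' (tgt e) du ℓ + 1 ≤ Λ.rM a' (tgt e + stepVec du))
    (hb : ∀ i, b i ≤ 3 * (P.r i : ℤ)) {v : V}
    (hv : v ∈ (cellGeomSG₂ G ψ P w₀ Λ).Ewv α e.1 e.2 ∪ (faceDataSG G ψ P w₀ Λ).Hfull a' (tgt e) du)
    (hH : ψ v ∈ P.Hfull (tgt e) du)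
    (hbox : Finset.Icc (ψ v - 1) (ψ v + 1) ⊆ Finset.Icc (P.cen (tgt e + stepVec du) - b) (P.cen (tgt e + stepVec du) + b)) :
    v ∈ VWin G ψ w₀ (Finset.Icc (P.cen (tgt e + stepVec du) - b) (P.cen (tgt e + stepVec du) + b)) (Λ.rM a' (tgt e + stepVec du)) := by
  rcases mem_Q_or_Hfull_of_mem_habΩ₂ hdu hv (Finset.mem_union_right _ hH) with hvQ | hvHs
  · -- footprint in `P.Q y` and in `cen(y+du) ± b ⊆ P.M (y+du) ⊆ P.Q (y+du)`: impossible
    have hvM0 : ψ v ∈ Finset.Icc (P.cen (tgt e + stepVec du) - b) (P.cen (tgt e + stepVec du) + b) :=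
      hbox (Finset.mem_Icc.2 ⟨fun i => by simp, fun i => by simp⟩)
    have hvM : ψ v ∈ P.M (tgt e + stepVec du) := by
      rw [Finset.mem_Icc, Pi.le_def, Pi.le_def] at hvM0
      rw [PCells2.M, PCells2.mem_abox_iff]
      intro i
      have h1 := hvM0.1 i; have h2 := hvM0.2 i; have h3 := hb i
      simp only [Pi.sub_apply, Pi.add_apply] at h1 h2
      push_cast
      constructor <;> linarith
    have h1 : ψ v ∈ P.Q (tgt e) := φ_mem_of_mem_VWin hvQ
    have h2 : ψ v ∈ P.Q (tgt e + stepVec du) := P.M_subset_Q _ hvM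
    have hne : tgt e ≠ tgt e + stepVec du := fun h' => by
      have h3 := congrArg (fun z => z du.1) h'
      simp only [Pi.add_apply, stepVec_apply_fst] at h3
      rcases sgOf_sign du with hs | hs <;> rw [hs] at h3 <;> linarith
    exact absurd h2 (Finset.disjoint_left.1 (P.Q_disjoint_Q hne) h1)
  · exact mem_Mb_of_mem_Hfull₂ hlip hρM hvHs hbox

end Rooms

end Skelφ

end Transplant

end Summit.CriticalPhenomena.PercolationContinuityZ3.Theorems

end
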